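import Summits.RiemannHypothesis.RiemannHypothesis.Theorems.WeilFormatCDeflatedFarEntryLimits
import Summits.RiemannHypothesis.RiemannHypothesis.Theorems.WeilFormatCDeflatedFarIdentify
import Summits.RiemannHypothesis.RiemannHypothesis.Theorems.WeilFormatCWindowCoeffDecay
import HarnessLib

/-!
# Format C, design C∞: cube decay of the sector profile tables and the profile Gram defect `E∞`

Route context: Fourier–Galerkin / Schur-complement certificates of Weil positivity on a window ("format C";
cell memo `run/shared/lean/pub/rh-explicit/rh-explicit-weil-10/KERNEL-LEVER.md` §18–§19; supporting
stmt-RiemannHypothesis-0098; seat rh-explicit-weil-10).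

The C∞ soundness theorem (`sum_range_mul_mul_nonneg_of_certificate_cinf`) needs `|V(n,j)| ≤ K/n³` for the profile tables
and the limit `E∞(j,j') = lim Σ_{n∈[B,P)} V(n,j)V(n,j')`.  For the sector tables of `WeilFormatCDeflatedFarSectorEven/Odd`
(`V⁺(n) = d_n² Re ĉ_n(1f)/√(2a)`, `V⁻(k) = 2 Im ĉ_{k+1}(1f)/√(2a)`) both follow from the cube decay of the window Fourier
coefficients of an admissible profile (`WeilFormatCWindowCoeffDecay.norm_fourierCoeff_le_cube`); the constant `K` is
EXISTENTIAL (it enters the convergence rate only, never the data):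

* `exists_norm_fourierCoeff_indicator_le_cube` — `∃ S ≥ 0, ‖ĉ_n(1f)‖ ≤ S/|n|³` (`n ≠ 0`) for `f ∈ C³`, `f(−a) = f(a)`,
  `f′(−a) = f′(a)`;
* `exists_evenTable_le_cube`, `exists_oddTable_le_cube` — `∃ K ≥ 0`, `|V⁺(n)| ≤ K/n³` (`n ≥ 1`), `|V⁻(k)| ≤ K/k³` (`k ≥ 1`);
* `tendsto_sum_Ico_mul_of_cube`, `abs_tsum_sub_sum_Ico_mul_le_of_cube` — for two tables with cube decay on `[B, ∞)`,
  `B ≥ 1`: `Σ_{n∈[B,P)} V(n)V'(n) → E∞ := Σ'_{n≥B} V(n)V'(n)` and the tail `|E∞ − Σ_{[B,Q)}| ≤ 2(KK'/Q⁴)/Q`.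

Standard axioms; no definitions; no RH claim.
-/

set_option autoImplicit false
-- `Summit.RiemannHypothesis.RiemannHypothesis.…` is the layout-mandated namespace (summit = problem name).
set_option linter.dupNamespace false

noncomputable section

open Complex Filter Set MeasureTheory Finset
open scoped Real Topology ComplexConjugate

namespace Summit.RiemannHypothesis.RiemannHypothesis.Theorems.WeilFormatC

open Literature.NumberTheory.LFunctions Literature.NumberTheory.LFunctions.Yoshida1992

variable {a : ℝ}

/-! ## Cube decay of the window Fourier coefficients of an admissible profile -/

/-- **Cube decay, existential constant**: for `f ∈ C³` with `f(−a) = f(a)`, `f′(−a) = f′(a)` (`a > 0`) there is `S ≥ 0`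
with `‖ĉ_n(1_{[−a,a]}f)‖ ≤ S/|n|³` for all `n ≠ 0`. -/
theorem exists_norm_fourierCoeff_indicator_le_cube (ha : 0 < a) {f : ℝ → ℂ} (hf : ContDiff ℝ 3 f)
    (hfe₀ : f (-a) = f a) (hfe₁ : deriv f (-a) = deriv f a) :
    ∃ S : ℝ, 0 ≤ S ∧ ∀ n : ℤ, n ≠ 0 →
      ‖Yoshida1992.fourierCoeff a n ((Icc (-a) a).indicator f)‖ ≤ S / |(n : ℝ)| ^ 3 := by
  obtain ⟨hf₀, hf₁, hf₂, hf₃⟩ := hasDerivAt_iteratedDeriv_of_contDiff_three hf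
  rw [← iteratedDeriv_one] at hfe₁
  set T : ℝ := ‖iteratedDeriv 2 f a‖ + ‖iteratedDeriv 2 f (-a)‖ + ∫ x in (-a)..a, ‖iteratedDeriv 3 f x‖ with hT
  have hT0 : 0 ≤ T := by
    have : 0 ≤ ∫ x in (-a)..a, ‖iteratedDeriv 3 f x‖ :=
      intervalIntegral.integral_nonneg (by linarith) fun x _ ↦ norm_nonneg _
    positivity
  refine ⟨(a / π) ^ 3 * T, by positivity, fun n hn ↦ ?_⟩
  rw [fourierCoeff_indicator ha.le]
  refine (norm_fourierCoeff_le_cube ha hn hf₀ hf₁ hf₂ hf₃ hfe₀ hfe₁).trans (le_of_eq ?_)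
  have hn' : 0 < |(n : ℝ)| := abs_pos.2 (by exact_mod_cast hn)
  rw [hT]
  field_simp

/-- **The even table decays like `n⁻³`**: `∃ K ≥ 0`, `|d_n² Re ĉ_n(1f)/√(2a)| ≤ K/n³` for `n ≥ 1`. -/
theorem exists_evenTable_le_cube (ha : 0 < a) {f : ℝ → ℂ} (hf : ContDiff ℝ 3 f)
    (hfe₀ : f (-a) = f a) (hfe₁ : deriv f (-a) = deriv f a) :
    ∃ K : ℝ, 0 ≤ K ∧ ∀ n : ℕ, 1 ≤ n →
      |(if n = 0 then 1 else 2) * (Yoshida1992.fourierCoeff a n ((Icc (-a) a).indicator f)).re / Real.sqrt (2 * a)|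
        ≤ K / (n : ℝ) ^ 3 := by
  obtain ⟨S, hS0, hS⟩ := exists_norm_fourierCoeff_indicator_le_cube ha hf hfe₀ hfe₁
  have hsa : 0 < Real.sqrt (2 * a) := Real.sqrt_pos.2 (by positivity)
  refine ⟨2 * S / Real.sqrt (2 * a), by positivity, fun n hn ↦ ?_⟩
  have hn0 : n ≠ 0 := by omega
  have hn' : (0 : ℝ) < n := by exact_mod_cast hn
  have h := hS n (by exact_mod_cast hn0)
  rw [Int.cast_natCast, abs_of_pos hn'] at h
  have hre := (Complex.abs_re_le_norm (Yoshida1992.fourierCoeff a n ((Icc (-a) a).indicator f))).trans h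
  rw [if_neg hn0, abs_div, abs_mul, abs_of_pos (by norm_num : (0 : ℝ) < 2), abs_of_pos hsa,
    div_le_iff₀ hsa]
  calc 2 * |(Yoshida1992.fourierCoeff a n ((Icc (-a) a).indicator f)).re| ≤ 2 * (S / (n : ℝ) ^ 3) := by linarith
    _ = 2 * S / Real.sqrt (2 * a) / (n : ℝ) ^ 3 * Real.sqrt (2 * a) := by field_simp

/-- **The odd table decays like `k⁻³`**: `∃ K ≥ 0`, `|2 Im ĉ_{k+1}(1f)/√(2a)| ≤ K/k³` for `k ≥ 1`
(decay in `(k+1)⁻³ ≤ k⁻³`). -/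
theorem exists_oddTable_le_cube (ha : 0 < a) {f : ℝ → ℂ} (hf : ContDiff ℝ 3 f)
    (hfe₀ : f (-a) = f a) (hfe₁ : deriv f (-a) = deriv f a) :
    ∃ K : ℝ, 0 ≤ K ∧ ∀ k : ℕ, 1 ≤ k →
      |2 * (Yoshida1992.fourierCoeff a ((k : ℤ) + 1) ((Icc (-a) a).indicator f)).im / Real.sqrt (2 * a)|
        ≤ K / (k : ℝ) ^ 3 := by
  obtain ⟨S, hS0, hS⟩ := exists_norm_fourierCoeff_indicator_le_cube ha hf hfe₀ hfe₁
  have hsa : 0 < Real.sqrt (2 * a) := Real.sqrt_pos.2 (by positivity)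
  refine ⟨2 * S / Real.sqrt (2 * a), by positivity, fun k hk ↦ ?_⟩
  have hk' : (0 : ℝ) < k := by exact_mod_cast hk
  have h := hS ((k : ℤ) + 1) (by omega)
  have hcast : |(((k : ℤ) + 1 : ℤ) : ℝ)| = (k : ℝ) + 1 := by
    push_cast
    exact abs_of_pos (by linarith)
  rw [hcast] at h
  have him := (Complex.abs_im_le_norm (Yoshida1992.fourierCoeff a ((k : ℤ) + 1) ((Icc (-a) a).indicator f))).trans h
  have hmono : S / ((k : ℝ) + 1) ^ 3 ≤ S / (k : ℝ) ^ 3 :=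
    div_le_div_of_nonneg_left hS0 (by positivity) (pow_le_pow_left₀ hk'.le (by linarith) 3)
  rw [abs_div, abs_mul, abs_of_pos (by norm_num : (0 : ℝ) < 2), abs_of_pos hsa, div_le_iff₀ hsa]
  calc 2 * |(Yoshida1992.fourierCoeff a ((k : ℤ) + 1) ((Icc (-a) a).indicator f)).im| ≤ 2 * (S / (k : ℝ) ^ 3) := by
        linarith
    _ = 2 * S / Real.sqrt (2 * a) / (k : ℝ) ^ 3 * Real.sqrt (2 * a) := by field_simp

/-! ## The profile Gram defect `E∞` from cube decay -/

section GramDefect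

variable {B : ℕ} {V V' : ℕ → ℝ} {K K' : ℝ}

/-- Products of two cube-decaying tables: `|V(n)V'(n)| ≤ KK'/n⁶` on `[B, ∞)`. -/
theorem abs_mul_le_of_cube (hK : 0 ≤ K) (hV : ∀ n, B ≤ n → |V n| ≤ K / (n : ℝ) ^ 3)
    (hV' : ∀ n, B ≤ n → |V' n| ≤ K' / (n : ℝ) ^ 3) {n : ℕ} (hn : B ≤ n) :
    |V n * V' n| ≤ K * K' / (n : ℝ) ^ 6 := by
  rw [abs_mul]
  calc |V n| * |V' n| ≤ (K / (n : ℝ) ^ 3) * (K' / (n : ℝ) ^ 3) :=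
        mul_le_mul (hV n hn) (hV' n hn) (abs_nonneg _) (div_nonneg hK (by positivity))
    _ = K * K' / (n : ℝ) ^ 6 := by rw [div_mul_div_comm]; ring

/-- **`E∞` exists and is the limit**: `Σ_{n∈[B,P)} V(n)V'(n) → Σ'_{n≥B} V(n)V'(n)` (`B ≥ 1`). -/
theorem tendsto_sum_Ico_mul_of_cube (hB : 1 ≤ B) (hK : 0 ≤ K) (hK' : 0 ≤ K')
    (hV : ∀ n, B ≤ n → |V n| ≤ K / (n : ℝ) ^ 3) (hV' : ∀ n, B ≤ n → |V' n| ≤ K' / (n : ℝ) ^ 3) :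
    Tendsto (fun P ↦ ∑ n ∈ Finset.Ico B P, V n * V' n) atTop
      (𝓝 (∑' n, if B ≤ n then V n * V' n else 0)) := by
  refine tendsto_sum_Ico_of_summable B (summable_ite_of_le_div_sq (mul_nonneg hK hK') fun n hn ↦ ?_)
  refine (abs_mul_le_of_cube hK hV hV' hn).trans ?_
  have h := div_pow_le_div_div_sq (mul_nonneg hK hK') hB hn 4
  have hB1 : (1 : ℝ) ≤ B := by exact_mod_cast hB
  exact h.trans (div_le_div_of_nonneg_right (div_le_self (mul_nonneg hK hK') (one_le_pow₀ hB1)) (by positivity))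

/-- **Tail of `E∞`**: `|E∞ − Σ_{n∈[B,Q)} V(n)V'(n)| ≤ 2(KK'/Q⁴)/Q` (`Q ≥ B ≥ 1`). -/
theorem abs_tsum_sub_sum_Ico_mul_le_of_cube (hB : 1 ≤ B) (hK : 0 ≤ K) (hK' : 0 ≤ K')
    (hV : ∀ n, B ≤ n → |V n| ≤ K / (n : ℝ) ^ 3) (hV' : ∀ n, B ≤ n → |V' n| ≤ K' / (n : ℝ) ^ 3)
    {Q : ℕ} (hBQ : B ≤ Q) :
    |(∑' n, if B ≤ n then V n * V' n else 0) - ∑ n ∈ Finset.Ico B Q, V n * V' n|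
      ≤ 2 * (K * K' / (Q : ℝ) ^ 4) / (Q : ℝ) := by
  have hQ : 1 ≤ Q := hB.trans hBQ
  refine abs_tsum_sub_sum_Ico_le hB hBQ (summable_ite_of_le_div_sq (mul_nonneg hK hK') fun n hn ↦ ?_)
    fun n hn ↦ ?_
  · refine (abs_mul_le_of_cube hK hV hV' hn).trans ?_
    have h := div_pow_le_div_div_sq (mul_nonneg hK hK') hB hn 4
    have hB1 : (1 : ℝ) ≤ B := by exact_mod_cast hB
    exact h.trans (div_le_div_of_nonneg_right (div_le_self (mul_nonneg hK hK') (one_le_pow₀ hB1)) (by positivity))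
  · exact (abs_mul_le_of_cube hK hV hV' (hBQ.trans hn)).trans (div_pow_le_div_div_sq (mul_nonneg hK hK') hQ hn 4)

end GramDefect

end Summit.RiemannHypothesis.RiemannHypothesis.Theorems.WeilFormatC

end
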